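import Literature.Geometry.Lorentzian.KerrConvergence
import HarnessLib

/-!
# `ε`-approximate `N`-Kerr configurations on a chart-time window

Companion to `KerrConvergence.lean` (`FinalStateDecomposition`, the `τ → ∞` object): the
**finite-closeness, finite-time** object "on the chart-time window `[τ, τ + L]` the region `O` of the
spacetime `𝓢` looks, in `Cᵏ` and up to `ε`, like `N` boosted sub-extremal Kerr black holes (near
zones of coordinate radius `R`) plus a flat radiation zone". It is the object quantified over by
"quiet window" / "no parking at extremality" statements (orbital closeness on a window, before any
asymptotic-stability theorem is applied; Klainerman, C. R. Mécanique 353 (2025), §1.1.1 (final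
state conjecture: "a finite number of Kerr black holes plus a radiative decaying term") and §1.2
(orbital stability: "remain close … for all time" versus asymptotic stability); Dafermos–Luk
arXiv:1710.01722, §1.2.1, p. 8 ("settle down to finitely many rotating Kerr black holes moving
away from each other"); DHRT arXiv:2104.08222, §1 and Klainerman–Szeftel, PAMQ 19 (2023),
Thm. 1.1 for the consequence-form conventions of `KerrConvergence.lean`).
**No printed formulation for `N ≥ 2` exists**; like `FinalStateDecomposition` this is a hypothesis
structure assembled from the generic layer of `KerrConvergence.lean` (`ModelBackground`,
`Spacetime.deviationCk`, `Spacetime.truncDeviationCk`, `boostedKerrBackground`,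
`Minkowski.backgroundOn`, `lorentzGroup`, `poincareInv`), and everything is a real definition.

## Contents (namespace `Literature.Geometry.Lorentzian`)

* windows of a reference background: `ModelBackground.window τ L = {τ ≤ t ≤ τ + L}`,
  `ModelBackground.truncWindow τ L R = {τ ≤ t ≤ τ + L, r ≤ R}` and their set algebra;
* `Spacetime.IsWindowChart B O W Ψ` — the window analogue of `Spacetime.IsLateChart`: `Ψ` smooth on
  the reference domain, an open topological embedding on some open neighbourhood of `W`, and
  `Ψ '' W ⊆ O`; `IsLateChart.isWindowChart`;
* the structure `ApproximateKerrConfiguration 𝓢 O k ε τ L R` and its API: `background`,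
  `flatBackground`, `nearZone`, `radiationZone`, `windowImage`, `certifiedSlab`, the covering
  restated (`diff_windowImage_subset`, `subset_windowImage_union`), `one_sub_sq_pos`
  (`0 < 1 − aᵢ²/Mᵢ²`), `setOf_sub_one_lt_subset_flatDomain`, monotonicity `mono` (in `ε`, up) and
  `ofLE` (in `k`, down);
* the sanity theorem `FinalStateDecomposition.eventually_nonempty_approximateKerrConfiguration`:
  a final state decomposition with strictly sub-extremal holes yields, for every `ε > 0`, `L`, `R`,
  configurations on all sufficiently late windows `[τ, τ + L]` — granted, on the window, the two
  clauses which relate DIFFERENT charts and are therefore not formal consequences of the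
  decomposition's data (see "Design choices", last item): the excision bound `ρᵢ ≤ R − 1` and the
  window covering clause `FinalStateDecomposition.IsWindowCovered`.

## Design choices

* **Window charts.** A configuration only speaks about the window; the chart maps are still total
  functions on the reference domains (as in `IsLateChart`, smoothness on the whole domain is a
  harmless normalisation), but the embedding property is asked only on some open neighbourhood of
  the window region and only the window region is mapped into `O`. A late-time chart after `τ₀`
  is a window chart for every window region inside `{t > τ₀}` (`IsLateChart.isWindowChart`).
* **Near zones are truncated, the radiation zone is not.** Hole `i` is certified on the truncated
  tube `{t*ᵢ ∈ [τ, τ + L], rᵢ ≤ R}` only (closeness `truncDeviationCk … k R σ ≤ ε`, embedding,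
  separation, covering all refer to it; the far part `rᵢ > R` of a hole chart is unconstrained junk,
  exactly as the far parts are excluded from the certified regions of the summit's
  `HasExhaustiveCharts`); the flat chart is certified on its whole window `{x⁰ ∈ [τ, τ + L]} ∩ U₀`
  (closeness `deviationCk ≤ ε` on the full flat slabs).
* **Excision radii are constants `ρᵢ ≤ R − 1` on the window** (request of route
  PhaseMixingCapture; cf. `FinalStateDecomposition.setOf_lt_excision_subset_flatDomain`, where over
  infinite time they must grow sublinearly): the flat domain contains the window slab
  `{x⁰ ∈ [τ, τ + L]}` minus the tubes `{rᵢ(Λᵢ⁻¹(x − cᵢ)) ≤ ρᵢ}` around the holes' straight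
  world-lines, so the flat chart's DOMAIN reaches a unit collar into every near zone `{rᵢ ≤ R}`
  (`setOf_sub_one_lt_subset_flatDomain` is the equivalent `ρᵢ = R − 1` form).
* **Strict sub-extremality** `|aᵢ| < Mᵢ` (`Kerr.IsSubextremal`, unlike the non-strict
  `FinalStateDecomposition.abs_spin_le_mass`), so that `0 < 1 − aᵢ²/Mᵢ²` (`one_sub_sq_pos`) and
  powers of it make sense.
* **Covering by causal trichotomy.** Every point of `O` outside the certified window images lies in
  the causal past `J⁻` of the certified slab at chart time `τ` or in the causal future `J⁺` of the
  certified slab at chart time `τ + L` (`certifiedSlab σ` = flat slab `{x⁰ = σ} ∩ U₀` plus the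
  truncated hole slabs `{t*ᵢ = σ, rᵢ ≤ R}`, the constant-radius form of the summit's certified slab).
  As in the summit, this is what ties chart time to causal order and forbids uncertified annuli
  between near zones and the radiation zone at window times.
* **`ε : ℝ≥0∞`**, the codomain of `deviationCk` (`ε = ∞` vacuous closeness, `ε = 0` isometric);
  `k`, `ε`, `τ`, `L`, `R` are parameters so that statements can quantify over them; no sign
  conditions are imposed (`L < 0` makes the window empty and the covering clause demanding).
* **No chart compatibility** between overlapping charts is recorded (as in
  `FinalStateDecomposition`); overlaps are constrained only semantically through closeness to the
  same spacetime metric and the covering clause.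
* **What the sanity theorem can and cannot derive.** From a `FinalStateDecomposition d` all METRIC
  clauses of a configuration on late windows follow formally (near-zone closeness out to any fixed
  `R`, flat closeness, separation, window charts, sub-extremality being assumed). Two clauses do
  not, for any structure of this kind: (i) `d`'s excision radii typically tend to `∞` (honest flat
  closeness forces `ρᵢ → ∞`), so `ρᵢ ≤ R − 1` on late windows is extra information about the window;
  (ii) the window covering involves the causal FUTURE of a certified slab and constant radii, while
  `d.diff_subset_causalPast` / the summit's `HasExhaustiveCharts` give causal PASTS of slabs with
  growing radii — relating them needs the causal character of the chart-time leaves, i.e. geometry,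
  not bookkeeping (summit AUDIT §D2: "monotone `ρᵢ ≤ Rᵢ − 1`" is how the expected geometry meets the
  clause, not a syntactic consequence). Both are therefore hypotheses, evaluated on the window, of
  `eventually_nonempty_approximateKerrConfiguration`.

## What is not here

The surface gravity `κ(M, a)` and `κ`-explicit basins (a separate request), the `ε`-version of the
whole decomposition (`QuasiFinalStateDecomposition`, another request), and any use of the summit-side
`Summit.FinalStateConjecture.certifiedSlab` / `HasExhaustiveCharts` (Literature does not import
`Summits`; the constant-radius analogues are spelled out here).

## References

* S. Klainerman, *The black hole stability problem*, C. R. Mécanique 353 (2025) 555–581, §1.1.1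
  (pp. 556–557), §1.2 (p. 560).
* M. Dafermos, J. Luk, *The interior of dynamical vacuum black holes I*, arXiv:1710.01722, §1.2.1,
  p. 8; Conjecture 1.
* M. Dafermos, G. Holzegel, I. Rodnianski, M. Taylor, arXiv:2104.08222, §1.
* S. Klainerman, J. Szeftel, *Kerr stability for small angular momentum*, PAMQ 19 (2023), Thm. 1.1.
-/

noncomputable section

open TopologicalSpace Manifold Filter Set Topology
open scoped ContDiff ENNReal

universe u

namespace Literature.Geometry.Lorentzian

/-! ### Windows of a reference background -/

namespace ModelBackground

/-- The **window region** `{x ∈ U | τ ≤ t(x) ≤ τ + L}` of a reference background between the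
chart times `τ` and `τ + L` (DHRT arXiv:2104.08222, §1: spacetime slabs bounded by two leaves of
the time function). [cite: arXiv210408222, §1] -/
def window (B : ModelBackground) (τ L : ℝ) : Set B.domain := {x | B.time x.1 ∈ Icc τ (τ + L)}

/-- The **truncated window region** (near-zone world tube over the window)
`{x ∈ U | τ ≤ t(x) ≤ τ + L, r(x) ≤ R}` (DHRT arXiv:2104.08222, §1, the region `{r ≤ R}`).
[cite: arXiv210408222, §1] -/
def truncWindow (B : ModelBackground) (τ L R : ℝ) : Set B.domain :=
  {x | B.time x.1 ∈ Icc τ (τ + L) ∧ B.radius x.1 ≤ R}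

/-- Membership in a window region. [folklore] -/
@[simp]
theorem mem_window {B : ModelBackground} {τ L : ℝ} {x : B.domain} :
    x ∈ B.window τ L ↔ B.time x.1 ∈ Icc τ (τ + L) := Iff.rfl

/-- Membership in a truncated window region. [folklore] -/
@[simp]
theorem mem_truncWindow {B : ModelBackground} {τ L R : ℝ} {x : B.domain} :
    x ∈ B.truncWindow τ L R ↔ B.time x.1 ∈ Icc τ (τ + L) ∧ B.radius x.1 ≤ R := Iff.rfl

/-- Truncated windows lie in the window. [folklore] -/
theorem truncWindow_subset_window (B : ModelBackground) (τ L R : ℝ) :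
    B.truncWindow τ L R ⊆ B.window τ L := fun _ hx ↦ hx.1

/-- Truncated windows grow with the radius. [folklore] -/
theorem truncWindow_mono (B : ModelBackground) (τ L : ℝ) {R R' : ℝ} (h : R ≤ R') :
    B.truncWindow τ L R ⊆ B.truncWindow τ L R' := fun _ hx ↦ ⟨hx.1, hx.2.trans h⟩

/-- The slabs at window times lie in the window. [folklore] -/
theorem timeSlab_subset_window (B : ModelBackground) {τ L σ : ℝ} (hσ : σ ∈ Icc τ (τ + L)) :
    B.timeSlab σ ⊆ B.window τ L := fun x hx ↦ by
  rw [mem_timeSlab] at hx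
  rw [mem_window, hx]
  exact hσ

/-- The truncated slabs at window times lie in the truncated window. [folklore] -/
theorem truncTimeSlab_subset_truncWindow (B : ModelBackground) {τ L σ : ℝ} (R : ℝ)
    (hσ : σ ∈ Icc τ (τ + L)) : B.truncTimeSlab R σ ⊆ B.truncWindow τ L R := fun x hx ↦ by
  rw [mem_truncTimeSlab] at hx
  rw [mem_truncWindow, hx.1]
  exact ⟨hσ, hx.2⟩

/-- The window is the union of its slabs. [folklore] -/
theorem window_eq_iUnion_timeSlab (B : ModelBackground) (τ L : ℝ) :
    B.window τ L = ⋃ σ ∈ Icc τ (τ + L), B.timeSlab σ := by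
  ext x
  simp only [mem_window, mem_iUnion, mem_timeSlab, exists_prop, exists_eq_right']

/-- The truncated window is the union of its truncated slabs. [folklore] -/
theorem truncWindow_eq_iUnion_truncTimeSlab (B : ModelBackground) (τ L R : ℝ) :
    B.truncWindow τ L R = ⋃ σ ∈ Icc τ (τ + L), B.truncTimeSlab R σ := by
  ext x
  simp only [mem_truncWindow, mem_iUnion, mem_truncTimeSlab, exists_prop]
  constructor
  · rintro ⟨ht, hr⟩
    exact ⟨B.time x.1, ht, rfl, hr⟩
  · rintro ⟨σ, hσ, rfl, hr⟩
    exact ⟨hσ, hr⟩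

/-- A window after `τ₀` lies in the late region `{t > τ₀}`. [folklore] -/
theorem window_subset_lateRegion (B : ModelBackground) {τ₀ τ : ℝ} (h : τ₀ < τ) (L : ℝ) :
    B.window τ L ⊆ B.lateRegion τ₀ := fun _ hx ↦ h.trans_le hx.1

/-- A truncated window after `τ₁` lies in the truncated late region `{t > τ₁, r ≤ R}`. [folklore] -/
theorem truncWindow_subset_truncLateRegion (B : ModelBackground) {τ₁ τ : ℝ} (h : τ₁ < τ)
    (L R : ℝ) : B.truncWindow τ L R ⊆ B.truncLateRegion τ₁ R :=
  fun _ hx ↦ ⟨h.trans_le hx.1.1, hx.2⟩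

/-- A truncated window after `τ₀` lies in the late region `{t > τ₀}`. [folklore] -/
theorem truncWindow_subset_lateRegion (B : ModelBackground) {τ₀ τ : ℝ} (h : τ₀ < τ) (L R : ℝ) :
    B.truncWindow τ L R ⊆ B.lateRegion τ₀ :=
  (B.truncWindow_subset_window τ L R).trans (B.window_subset_lateRegion h L)

/-- If the time function is continuous, late regions are open in the reference domain. [folklore] -/
theorem isOpen_lateRegion (B : ModelBackground) (hB : Continuous B.time) (τ₀ : ℝ) :
    IsOpen (B.lateRegion τ₀) :=
  isOpen_lt continuous_const (hB.comp continuous_subtype_val)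

end ModelBackground

/-- The time function `x ↦ (Λ⁻¹(x − c))⁰` of a boosted Kerr background is continuous.
[folklore] -/
theorem continuous_time_boostedKerrBackground (Λ : lorentzGroup) (c : E4) (M a : ℝ) :
    Continuous (boostedKerrBackground Λ c M a).time :=
  (PiLp.continuous_apply 2 _ 0).comp (continuous_poincareInv Λ c)

/-- The time function `x ↦ x⁰` of the Minkowski background on `U` is continuous. [folklore] -/
theorem Minkowski.continuous_time_backgroundOn (U : Opens E4) :
    Continuous (Minkowski.backgroundOn U).time :=
  PiLp.continuous_apply 2 _ 0

/-! ### Window charts -/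

namespace Spacetime

variable (𝓢 : Spacetime.{u} 4) (B : ModelBackground)

/-- `Ψ : U → 𝓢.carrier` is a **window chart** into the region `O ⊆ 𝓢.carrier` for the window
region `W ⊆ U` of the background `B` (the window analogue of `IsLateChart`, whose late region
`{t > τ₀}` is replaced by an arbitrary set `W`, in practice `B.window τ L` or `B.truncWindow τ L R`):
`Ψ` is smooth on the reference domain, restricts to an open topological embedding of some open
neighbourhood of `W`, and maps `W` into `O`. DHRT arXiv:2104.08222, §1; Klainerman–Szeftel,
PAMQ 19 (2023), Thm. 1.1 (consequence-form charts, see `KerrConvergence.lean`).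
[cite: arXiv210408222, §1] -/
structure IsWindowChart (O : Set 𝓢.carrier) (W : Set B.domain) (Ψ : B.domain → 𝓢.carrier) :
    Prop where
  /-- `Ψ` is smooth on the reference domain. -/
  contMDiff : ContMDiff 𝓘(ℝ, E4) (𝓡 4) ∞ Ψ
  /-- `Ψ` restricted to some open neighbourhood `V ⊇ W` is an open embedding. -/
  exists_isOpenEmbedding : ∃ V : Set B.domain, IsOpen V ∧ W ⊆ V ∧ IsOpenEmbedding (V.restrict Ψ)
  /-- The window region is mapped into `O`. -/
  image_subset : Ψ '' W ⊆ O

variable {𝓢 B}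

/-- A window chart is a window chart for every smaller window region and every larger target
region. [folklore] -/
theorem IsWindowChart.mono {O O' : Set 𝓢.carrier} {W W' : Set B.domain}
    {Ψ : B.domain → 𝓢.carrier} (h : 𝓢.IsWindowChart B O W Ψ) (hO : O ⊆ O') (hW : W' ⊆ W) :
    𝓢.IsWindowChart B O' W' Ψ where
  contMDiff := h.contMDiff
  exists_isOpenEmbedding := by
    obtain ⟨V, hV, hWV, hΨ⟩ := h.exists_isOpenEmbedding
    exact ⟨V, hV, hW.trans hWV, hΨ⟩
  image_subset := (image_mono hW).trans (h.image_subset.trans hO)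

/-- A window chart is injective on its window region. [folklore] -/
theorem IsWindowChart.injOn {O : Set 𝓢.carrier} {W : Set B.domain} {Ψ : B.domain → 𝓢.carrier}
    (h : 𝓢.IsWindowChart B O W Ψ) : InjOn Ψ W := by
  obtain ⟨V, -, hWV, hΨ⟩ := h.exists_isOpenEmbedding
  exact (injOn_iff_injective.2 hΨ.injective).mono hWV

/-- A window chart has an open neighbourhood of its window region with open image. [folklore] -/
theorem IsWindowChart.exists_isOpen_image {O : Set 𝓢.carrier} {W : Set B.domain}
    {Ψ : B.domain → 𝓢.carrier} (h : 𝓢.IsWindowChart B O W Ψ) :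
    ∃ V : Set B.domain, IsOpen V ∧ W ⊆ V ∧ IsOpen (Ψ '' V) := by
  obtain ⟨V, hV, hWV, hΨ⟩ := h.exists_isOpenEmbedding
  refine ⟨V, hV, hWV, ?_⟩
  rw [← range_restrict]
  exact hΨ.isOpen_range

/-- A late-time chart after `τ₀` (with open late region, e.g. for a continuous time function) is a
window chart for every window region inside the late region `{t > τ₀}`.
DHRT arXiv:2104.08222, §1. [cite: arXiv210408222, §1] -/
theorem IsLateChart.isWindowChart {O : Set 𝓢.carrier} {τ₀ : ℝ} {Ψ : B.domain → 𝓢.carrier}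
    (h : 𝓢.IsLateChart B O τ₀ Ψ) (hopen : IsOpen (B.lateRegion τ₀)) {W : Set B.domain}
    (hW : W ⊆ B.lateRegion τ₀) : 𝓢.IsWindowChart B O W Ψ where
  contMDiff := h.contMDiff
  exists_isOpenEmbedding := ⟨B.lateRegion τ₀, hopen, hW, h.isOpenEmbedding⟩
  image_subset := (image_mono hW).trans h.image_subset

end Spacetime

/-! ### The configuration -/

/-- **Hypothesis structure: an `ε`-approximate `N`-Kerr configuration** on the chart-time window
`[τ, τ + L]` of the region `O ⊆ 𝓢.carrier`, in `Cᵏ`, with near-zone radius `R`. The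
finite-closeness / finite-time companion of `FinalStateDecomposition` (folklore final state
picture: Klainerman, C. R. Mécanique 353 (2025), §1.1.1, "a finite number of Kerr black holes plus
a radiative decaying term", and §1.2, orbital closeness "remain close … for all time" as opposed to
convergence; Dafermos–Luk arXiv:1710.01722, §1.2.1; **no printed formulation for `N ≥ 2` exists**).
Data: the number `N`; masses/spins with `0 < Mᵢ` and the STRICT `|aᵢ| < Mᵢ` (`Kerr.IsSubextremal`);
motions `(Λᵢ, cᵢ)`; hole charts `chart i` on the boosted Kerr exteriors which are window charts
(`Spacetime.IsWindowChart`) into `O` for the truncated tubes `{t*ᵢ ∈ [τ, τ + L], rᵢ ≤ R}`, with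
`Cᵏ` deviation from boosted Kerr at most `ε` on every truncated slab `{t*ᵢ = σ, rᵢ ≤ R}`,
`σ ∈ [τ, τ + L]`, and pairwise disjoint images of the truncated tubes; constant excision radii
`ρᵢ ≤ R − 1`; a flat chart on `flatDomain ⊇ {x⁰ ∈ [τ, τ + L]} ∖ ⋃ᵢ {rᵢ(Λᵢ⁻¹(x − cᵢ)) ≤ ρᵢ}` which is a
window chart into `O` for `{x⁰ ∈ [τ, τ + L]} ∩ flatDomain` with full `Cᵏ` deviation from `η` at most
`ε` on every flat slab of the window; and the covering clause: every point of `O` outside these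
certified window images lies in the causal past of the certified slab at time `τ` or in the causal
future of the certified slab at time `τ + L` (module docstring, "Design choices").
[cite: Klainerman2025, §1.1.1] -/
structure ApproximateKerrConfiguration (𝓢 : Spacetime.{u} 4) (O : Set 𝓢.carrier) (k : ℕ)
    (ε : ℝ≥0∞) (τ L R : ℝ) where
  /-- The number of black holes. -/
  N : ℕ
  /-- The masses `Mᵢ`. -/
  mass : Fin N → ℝ
  /-- The specific angular momenta `aᵢ`. -/
  spin : Fin N → ℝ
  /-- Each mass is positive, `0 < Mᵢ`. -/
  mass_pos : ∀ i, 0 < mass i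
  /-- Each hole is strictly sub-extremal, `|aᵢ| < Mᵢ`. -/
  isSubextremal : ∀ i, Kerr.IsSubextremal (mass i) (spin i)
  /-- The motion `(Λᵢ, cᵢ)` (boost/rotation and translation) of hole `i` on the window. -/
  motion : Fin N → lorentzGroup × E4
  /-- The chart of hole `i`, on the boosted Kerr exterior `boostedKerrExterior Λᵢ cᵢ Mᵢ aᵢ`. -/
  chart : ∀ i, boostedKerrExterior (motion i).1 (motion i).2 (mass i) (spin i) → 𝓢.carrier
  /-- Each `chart i` is a window chart into `O` for the truncated tube
  `{t*ᵢ ∈ [τ, τ + L], rᵢ ≤ R}`. -/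
  isWindowChart : ∀ i, 𝓢.IsWindowChart
    (boostedKerrBackground (motion i).1 (motion i).2 (mass i) (spin i)) O
    ((boostedKerrBackground (motion i).1 (motion i).2 (mass i) (spin i)).truncWindow τ L R)
    (chart i)
  /-- Near-zone closeness: the `Cᵏ` deviation of `(chart i)^* g` from boosted Kerr
  `(Mᵢ, aᵢ, Λᵢ, cᵢ)` on every truncated slab `{t*ᵢ = σ, rᵢ ≤ R}`, `σ ∈ [τ, τ + L]`, is `≤ ε`. -/
  truncDeviationCk_le : ∀ i, ∀ σ ∈ Icc τ (τ + L), 𝓢.truncDeviationCk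
    (boostedKerrBackground (motion i).1 (motion i).2 (mass i) (spin i)) (chart i) k R σ ≤ ε
  /-- Separation: the images of the truncated tubes `{t*ᵢ ∈ [τ, τ + L], rᵢ ≤ R}` are pairwise
  disjoint. -/
  pairwise_disjoint : Pairwise (Function.onFun Disjoint fun i ↦
    chart i '' (boostedKerrBackground (motion i).1 (motion i).2 (mass i) (spin i)).truncWindow
      τ L R)
  /-- The (constant) excision radius `ρᵢ` of the tube around hole `i` in the flat chart. -/
  excision : Fin N → ℝ
  /-- The excised tubes end a unit collar inside the near zones: `ρᵢ ≤ R − 1`. -/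
  excision_le : ∀ i, excision i ≤ R - 1
  /-- The coordinate domain `U₀ ⊆ E4` of the flat (radiation-zone) chart. -/
  flatDomain : Opens E4
  /-- The flat domain contains the window slab `{x⁰ ∈ [τ, τ + L]}` minus the excised tubes
  `{rᵢ(Λᵢ⁻¹(x − cᵢ)) ≤ ρᵢ}` around the holes' straight world-lines. -/
  setOf_lt_excision_subset_flatDomain :
    {x : E4 | x 0 ∈ Icc τ (τ + L) ∧ ∀ i, excision i <
      Kerr.radius (spin i) (poincareInv (motion i).1 (motion i).2 x)} ⊆ flatDomain
  /-- The flat (radiation-zone) chart. -/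
  flatChart : flatDomain → 𝓢.carrier
  /-- The flat chart is a window chart into `O` for the flat window `{x⁰ ∈ [τ, τ + L]} ∩ U₀`
  (Minkowski background on `flatDomain`, time `x⁰`). -/
  isWindowChart_flat : 𝓢.IsWindowChart (Minkowski.backgroundOn flatDomain) O
    ((Minkowski.backgroundOn flatDomain).window τ L) flatChart
  /-- Radiation-zone closeness: the full `Cᵏ` deviation of `flatChart^* g` from `η` on every flat
  slab `{x⁰ = σ} ∩ U₀`, `σ ∈ [τ, τ + L]`, is `≤ ε`. -/
  deviationCk_flat_le : ∀ σ ∈ Icc τ (τ + L),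
    𝓢.deviationCk (Minkowski.backgroundOn flatDomain) flatChart k σ ≤ ε
  /-- Covering clause: every point of `O` outside the certified window images (flat window and
  truncated hole tubes) lies in the causal past of the certified slab at time `τ` or in the causal
  future of the certified slab at time `τ + L`. -/
  diff_subset :
    O \ (flatChart '' (Minkowski.backgroundOn flatDomain).window τ L ∪
        ⋃ i, chart i '' (boostedKerrBackground (motion i).1 (motion i).2 (mass i)
          (spin i)).truncWindow τ L R) ⊆
      𝓢.metric.causalPast 𝓢.timeOrientation
          (flatChart '' (Minkowski.backgroundOn flatDomain).timeSlab τ ∪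
            ⋃ i, chart i '' (boostedKerrBackground (motion i).1 (motion i).2 (mass i)
              (spin i)).truncTimeSlab R τ) ∪
        𝓢.metric.causalFuture 𝓢.timeOrientation
          (flatChart '' (Minkowski.backgroundOn flatDomain).timeSlab (τ + L) ∪
            ⋃ i, chart i '' (boostedKerrBackground (motion i).1 (motion i).2 (mass i)
              (spin i)).truncTimeSlab R (τ + L))

namespace ApproximateKerrConfiguration

variable {𝓢 : Spacetime.{u} 4} {O : Set 𝓢.carrier} {k : ℕ} {ε : ℝ≥0∞} {τ L R : ℝ}

/-- The reference background of hole `i` (boosted Kerr `(Mᵢ, aᵢ)` with motion `(Λᵢ, cᵢ)`).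
[folklore] -/
def background (c : ApproximateKerrConfiguration 𝓢 O k ε τ L R) (i : Fin c.N) : ModelBackground :=
  boostedKerrBackground (c.motion i).1 (c.motion i).2 (c.mass i) (c.spin i)

/-- The flat reference background (Minkowski on the flat domain). [folklore] -/
def flatBackground (c : ApproximateKerrConfiguration 𝓢 O k ε τ L R) : ModelBackground :=
  Minkowski.backgroundOn c.flatDomain

/-- The **near zone** of hole `i` on the window: the image of the truncated tube
`{t*ᵢ ∈ [τ, τ + L], rᵢ ≤ R}`. [cite: Klainerman2025, §1.1.1] -/
def nearZone (c : ApproximateKerrConfiguration 𝓢 O k ε τ L R) (i : Fin c.N) : Set 𝓢.carrier :=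
  c.chart i '' (c.background i).truncWindow τ L R

/-- The **radiation zone** on the window: the image of the flat window `{x⁰ ∈ [τ, τ + L]} ∩ U₀`.
[cite: Klainerman2025, §1.1.1] -/
def radiationZone (c : ApproximateKerrConfiguration 𝓢 O k ε τ L R) : Set 𝓢.carrier :=
  c.flatChart '' c.flatBackground.window τ L

/-- The **certified window image**: radiation zone and near zones. [cite: Klainerman2025, §1.1.1] -/
def windowImage (c : ApproximateKerrConfiguration 𝓢 O k ε τ L R) : Set 𝓢.carrier :=
  c.radiationZone ∪ ⋃ i, c.nearZone i

/-- The **certified slab at chart time `σ`**: the flat chart's image of `{x⁰ = σ} ∩ U₀` and the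
hole charts' images of the truncated slabs `{t*ᵢ = σ, rᵢ ≤ R}` (constant-radius form of the
summit's certified slab). [cite: DafermosLuk2017, Conjecture 1] -/
def certifiedSlab (c : ApproximateKerrConfiguration 𝓢 O k ε τ L R) (σ : ℝ) : Set 𝓢.carrier :=
  c.flatChart '' c.flatBackground.timeSlab σ ∪ ⋃ i, c.chart i '' (c.background i).truncTimeSlab R σ

/-- Each hole is strictly sub-extremal, `|aᵢ| < Mᵢ`. [folklore] -/
theorem abs_spin_lt_mass (c : ApproximateKerrConfiguration 𝓢 O k ε τ L R) (i : Fin c.N) :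
    |c.spin i| < c.mass i :=
  c.isSubextremal i

/-- `0 < 1 − aᵢ²/Mᵢ²` for each hole (so that real powers of it are meaningful). [folklore] -/
theorem one_sub_sq_pos (c : ApproximateKerrConfiguration 𝓢 O k ε τ L R) (i : Fin c.N) :
    0 < 1 - (c.spin i / c.mass i) ^ 2 := by
  have h : |c.spin i / c.mass i| < 1 := by
    rw [abs_div, abs_of_pos (c.mass_pos i), div_lt_one (c.mass_pos i)]
    exact c.isSubextremal i
  exact sub_pos.2 ((sq_lt_one_iff_abs_lt_one _).2 h)

/-- Each near zone lies in `O`. [folklore] -/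
theorem nearZone_subset (c : ApproximateKerrConfiguration 𝓢 O k ε τ L R) (i : Fin c.N) :
    c.nearZone i ⊆ O :=
  (c.isWindowChart i).image_subset

/-- The radiation zone lies in `O`. [folklore] -/
theorem radiationZone_subset (c : ApproximateKerrConfiguration 𝓢 O k ε τ L R) :
    c.radiationZone ⊆ O :=
  c.isWindowChart_flat.image_subset

/-- The certified window image lies in `O`. [folklore] -/
theorem windowImage_subset (c : ApproximateKerrConfiguration 𝓢 O k ε τ L R) :
    c.windowImage ⊆ O :=
  union_subset c.radiationZone_subset (iUnion_subset c.nearZone_subset)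

/-- The certified slabs at window times lie in the certified window image. [folklore] -/
theorem certifiedSlab_subset_windowImage (c : ApproximateKerrConfiguration 𝓢 O k ε τ L R) {σ : ℝ}
    (hσ : σ ∈ Icc τ (τ + L)) : c.certifiedSlab σ ⊆ c.windowImage :=
  union_subset_union (image_mono (c.flatBackground.timeSlab_subset_window hσ))
    (iUnion_mono fun i ↦ image_mono ((c.background i).truncTimeSlab_subset_truncWindow R hσ))

/-- The certified slabs at window times lie in `O`. [folklore] -/
theorem certifiedSlab_subset (c : ApproximateKerrConfiguration 𝓢 O k ε τ L R) {σ : ℝ}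
    (hσ : σ ∈ Icc τ (τ + L)) : c.certifiedSlab σ ⊆ O :=
  (c.certifiedSlab_subset_windowImage hσ).trans c.windowImage_subset

/-- The near zones are pairwise disjoint. [folklore] -/
theorem pairwise_disjoint_nearZone (c : ApproximateKerrConfiguration 𝓢 O k ε τ L R) :
    Pairwise (Function.onFun Disjoint c.nearZone) :=
  c.pairwise_disjoint

/-- Each hole chart is injective on its truncated tube. [folklore] -/
theorem injOn_chart (c : ApproximateKerrConfiguration 𝓢 O k ε τ L R) (i : Fin c.N) :
    InjOn (c.chart i) ((c.background i).truncWindow τ L R) :=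
  (c.isWindowChart i).injOn

/-- The flat chart is injective on the flat window. [folklore] -/
theorem injOn_flatChart (c : ApproximateKerrConfiguration 𝓢 O k ε τ L R) :
    InjOn c.flatChart (c.flatBackground.window τ L) :=
  c.isWindowChart_flat.injOn

/-- **Covering**, restated with the named sets: `O ∖ windowImage ⊆ J⁻(certifiedSlab τ) ∪
J⁺(certifiedSlab (τ + L))`. [cite: Klainerman2025, §1.1.1] -/
theorem diff_windowImage_subset (c : ApproximateKerrConfiguration 𝓢 O k ε τ L R) :
    O \ c.windowImage ⊆
      𝓢.metric.causalPast 𝓢.timeOrientation (c.certifiedSlab τ) ∪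
        𝓢.metric.causalFuture 𝓢.timeOrientation (c.certifiedSlab (τ + L)) :=
  c.diff_subset

/-- **Causal trichotomy** of `O` relative to the window: every point of `O` is certified on the
window, or causally before the certified slab at `τ`, or causally after the certified slab at
`τ + L`. [cite: Klainerman2025, §1.1.1] -/
theorem subset_windowImage_union (c : ApproximateKerrConfiguration 𝓢 O k ε τ L R) :
    O ⊆ c.windowImage ∪ (𝓢.metric.causalPast 𝓢.timeOrientation (c.certifiedSlab τ) ∪
      𝓢.metric.causalFuture 𝓢.timeOrientation (c.certifiedSlab (τ + L))) := fun p hp ↦ by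
  by_cases h : p ∈ c.windowImage
  · exact Or.inl h
  · exact Or.inr (c.diff_windowImage_subset ⟨hp, h⟩)

/-- The flat domain contains the window slab minus the tubes of radius `R − 1` (the `ρᵢ = R − 1`
form of `setOf_lt_excision_subset_flatDomain`): the flat chart's domain reaches a unit collar into
every near zone. [folklore] -/
theorem setOf_sub_one_lt_subset_flatDomain (c : ApproximateKerrConfiguration 𝓢 O k ε τ L R) :
    {x : E4 | x 0 ∈ Icc τ (τ + L) ∧ ∀ i, R - 1 <
      Kerr.radius (c.spin i) (poincareInv (c.motion i).1 (c.motion i).2 x)} ⊆ c.flatDomain :=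
  fun _ hx ↦ c.setOf_lt_excision_subset_flatDomain
    ⟨hx.1, fun i ↦ (c.excision_le i).trans_lt (hx.2 i)⟩

/-- Near-zone closeness holds out to every smaller radius `R' ≤ R`. [folklore] -/
theorem truncDeviationCk_le_of_le (c : ApproximateKerrConfiguration 𝓢 O k ε τ L R) (i : Fin c.N)
    {R' : ℝ} (hR : R' ≤ R) {σ : ℝ} (hσ : σ ∈ Icc τ (τ + L)) :
    𝓢.truncDeviationCk (c.background i) (c.chart i) k R' σ ≤ ε :=
  (𝓢.truncDeviationCk_mono _ _ k hR σ).trans (c.truncDeviationCk_le i σ hσ)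

/-- **Monotonicity in `ε` (up)**: an `ε`-approximate configuration is `ε'`-approximate for
`ε ≤ ε'`, with the same data. [folklore] -/
def mono {ε' : ℝ≥0∞} (c : ApproximateKerrConfiguration 𝓢 O k ε τ L R) (h : ε ≤ ε') :
    ApproximateKerrConfiguration 𝓢 O k ε' τ L R where
  N := c.N
  mass := c.mass
  spin := c.spin
  mass_pos := c.mass_pos
  isSubextremal := c.isSubextremal
  motion := c.motion
  chart := c.chart
  isWindowChart := c.isWindowChart
  truncDeviationCk_le i σ hσ := (c.truncDeviationCk_le i σ hσ).trans h
  pairwise_disjoint := c.pairwise_disjoint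
  excision := c.excision
  excision_le := c.excision_le
  flatDomain := c.flatDomain
  setOf_lt_excision_subset_flatDomain := c.setOf_lt_excision_subset_flatDomain
  flatChart := c.flatChart
  isWindowChart_flat := c.isWindowChart_flat
  deviationCk_flat_le σ hσ := (c.deviationCk_flat_le σ hσ).trans h
  diff_subset := c.diff_subset

/-- **Monotonicity in `k` (down)**: a configuration in `Cᵏ'` is one in `Cᵏ` for `k ≤ k'`, with the
same data (all `Cᵏ` sup norms are monotone in `k`, `supCkENorm_mono_right`).
DHRT arXiv:2104.08222, §1 (loss of derivatives). [cite: arXiv210408222, §1] -/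
def ofLE {k' : ℕ} (c : ApproximateKerrConfiguration 𝓢 O k' ε τ L R) (h : k ≤ k') :
    ApproximateKerrConfiguration 𝓢 O k ε τ L R where
  N := c.N
  mass := c.mass
  spin := c.spin
  mass_pos := c.mass_pos
  isSubextremal := c.isSubextremal
  motion := c.motion
  chart := c.chart
  isWindowChart := c.isWindowChart
  truncDeviationCk_le i σ hσ := (supCkENorm_mono_right _ h _).trans (c.truncDeviationCk_le i σ hσ)
  pairwise_disjoint := c.pairwise_disjoint
  excision := c.excision
  excision_le := c.excision_le
  flatDomain := c.flatDomain
  setOf_lt_excision_subset_flatDomain := c.setOf_lt_excision_subset_flatDomain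
  flatChart := c.flatChart
  isWindowChart_flat := c.isWindowChart_flat
  deviationCk_flat_le σ hσ := (supCkENorm_mono_right _ h _).trans (c.deviationCk_flat_le σ hσ)
  diff_subset := c.diff_subset

/-- `mono` keeps the number of holes. [folklore] -/
@[simp]
theorem mono_N {ε' : ℝ≥0∞} (c : ApproximateKerrConfiguration 𝓢 O k ε τ L R) (h : ε ≤ ε') :
    (c.mono h).N = c.N := rfl

/-- `mono` keeps the certified window image. [folklore] -/
@[simp]
theorem windowImage_mono {ε' : ℝ≥0∞} (c : ApproximateKerrConfiguration 𝓢 O k ε τ L R)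
    (h : ε ≤ ε') : (c.mono h).windowImage = c.windowImage := rfl

/-- `ofLE` keeps the number of holes. [folklore] -/
@[simp]
theorem ofLE_N {k' : ℕ} (c : ApproximateKerrConfiguration 𝓢 O k' ε τ L R) (h : k ≤ k') :
    (c.ofLE h).N = c.N := rfl

/-- `ofLE` keeps the certified window image. [folklore] -/
@[simp]
theorem windowImage_ofLE {k' : ℕ} (c : ApproximateKerrConfiguration 𝓢 O k' ε τ L R)
    (h : k ≤ k') : (c.ofLE h).windowImage = c.windowImage := rfl

end ApproximateKerrConfiguration

/-! ### Sanity: late windows of a final state decomposition -/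

namespace FinalStateDecomposition

variable {𝓢 : Spacetime.{u} 4} {O : Set 𝓢.carrier} {k : ℕ}

/-- The **window covering clause for the charts of a final state decomposition `d`** at constant
near-zone radius `R` on the chart-time window `[τ, τ + L]`: every point of `O` outside
`flatChart({x⁰ ∈ [τ, τ + L]} ∩ U₀) ∪ ⋃ᵢ chartᵢ({t*ᵢ ∈ [τ, τ + L], rᵢ ≤ R})` lies in the causal past of
`d`'s constant-radius certified slab at `τ` or in the causal future of the one at `τ + L` (exactly
the clause `ApproximateKerrConfiguration.diff_subset` for `d`'s charts). It is NOT a formal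
consequence of `d.diff_subset_causalPast` (causal pasts only, growing radii; module docstring).
[cite: Klainerman2025, §1.1.1] -/
def IsWindowCovered (d : FinalStateDecomposition 𝓢 O k) (τ L R : ℝ) : Prop :=
  O \ (d.flatChart '' (Minkowski.backgroundOn d.flatDomain).window τ L ∪
      ⋃ i, d.chart i '' (d.background i).truncWindow τ L R) ⊆
    𝓢.metric.causalPast 𝓢.timeOrientation
        (d.flatChart '' (Minkowski.backgroundOn d.flatDomain).timeSlab τ ∪
          ⋃ i, d.chart i '' (d.background i).truncTimeSlab R τ) ∪
      𝓢.metric.causalFuture 𝓢.timeOrientation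
        (d.flatChart '' (Minkowski.backgroundOn d.flatDomain).timeSlab (τ + L) ∪
          ⋃ i, d.chart i '' (d.background i).truncTimeSlab R (τ + L))

/-- **Sanity (late windows of a final state decomposition).** Let `d` be an `N`-black-hole final
state decomposition of `O` in `Cᵏ` with strictly sub-extremal holes, `0 < ε`, `L`, `R` arbitrary.
Then for all sufficiently late `τ`: if on the window `[τ, τ + L]` the excision radii of `d` satisfy
`ρᵢ(t) ≤ R − 1` and `d`'s charts satisfy the window covering clause at radius `R`, the charts of
`d` form an `ε`-approximate `N`-Kerr configuration on `[τ, τ + L]` with near-zone radius `R` (same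
`N`, parameters, motions, charts and flat domain; constant excision radii `R − 1`). All metric
clauses come from `d`: near-zone closeness from `tendsto_truncDeviationCk`, flat closeness from
`tendsto_deviationCk_flat`, separation from `exists_pairwise_disjoint`, window charts from the
late-time charts (`IsLateChart.isWindowChart`, the time functions being continuous).
DHRT arXiv:2104.08222, §1 (convergence implies eventual `ε`-closeness). [cite: arXiv210408222, §1] -/
theorem eventually_nonempty_approximateKerrConfiguration (d : FinalStateDecomposition 𝓢 O k)
    (hd : ∀ i, Kerr.IsSubextremal (d.mass i) (d.spin i)) {ε : ℝ≥0∞} (hε : 0 < ε) (L R : ℝ) :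
    ∀ᶠ τ in atTop, (∀ i, ∀ t ∈ Icc τ (τ + L), d.excision i t ≤ R - 1) →
      d.IsWindowCovered τ L R → Nonempty (ApproximateKerrConfiguration 𝓢 O k ε τ L R) := by
  -- near-zone closeness out to `R`, uniformly on late windows
  have h1 : ∀ᶠ τ in atTop, ∀ i, ∀ σ, τ ≤ σ →
      𝓢.truncDeviationCk (d.background i) (d.chart i) k R σ ≤ ε := by
    refine eventually_all.2 fun i ↦ eventually_forall_ge_atTop.2 ?_
    exact (d.tendsto_truncDeviationCk i R).eventually (ge_mem_nhds hε)
  -- flat closeness, uniformly on late windows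
  have h2 : ∀ᶠ τ in atTop, ∀ σ, τ ≤ σ →
      𝓢.deviationCk (Minkowski.backgroundOn d.flatDomain) d.flatChart k σ ≤ ε :=
    eventually_forall_ge_atTop.2 (d.tendsto_deviationCk_flat.eventually (ge_mem_nhds hε))
  -- separation out to `R`
  obtain ⟨τ₁, hτ₁⟩ := d.exists_pairwise_disjoint R
  filter_upwards [h1, h2, eventually_gt_atTop τ₁, eventually_gt_atTop d.τ₀] with τ hτ1 hτ2 hττ₁
    hττ₀ hexc hcov
  refine ⟨{
    N := d.N
    mass := d.mass
    spin := d.spin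
    mass_pos := d.mass_pos
    isSubextremal := hd
    motion := d.motion
    chart := d.chart
    isWindowChart := fun i ↦ (d.isLateChart i).isWindowChart
      ((d.background i).isOpen_lateRegion (continuous_time_boostedKerrBackground _ _ _ _) d.τ₀)
      ((d.background i).truncWindow_subset_lateRegion hττ₀ L R)
    truncDeviationCk_le := fun i σ hσ ↦ hτ1 i σ hσ.1
    pairwise_disjoint := hτ₁.mono fun i j hij ↦ hij.mono
      (image_mono ((d.background i).truncWindow_subset_truncLateRegion hττ₁ L R))
      (image_mono ((d.background j).truncWindow_subset_truncLateRegion hττ₁ L R))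
    excision := fun _ ↦ R - 1
    excision_le := fun _ ↦ le_rfl
    flatDomain := d.flatDomain
    setOf_lt_excision_subset_flatDomain := fun x hx ↦ d.setOf_lt_excision_subset_flatDomain
      ⟨hττ₀.trans_le hx.1.1, fun i ↦ (hexc i (x 0) hx.1).trans_lt (hx.2 i)⟩
    flatChart := d.flatChart
    isWindowChart_flat := d.isLateChart_flat.isWindowChart
      ((Minkowski.backgroundOn d.flatDomain).isOpen_lateRegion
        (Minkowski.continuous_time_backgroundOn d.flatDomain) d.τ₀)
      ((Minkowski.backgroundOn d.flatDomain).window_subset_lateRegion hττ₀ L)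
    deviationCk_flat_le := fun σ hσ ↦ hτ2 σ hσ.1
    diff_subset := hcov }⟩

end FinalStateDecomposition

end Literature.Geometry.Lorentzian

end
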